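import Mathlib
import HarnessLib
import Literature.MathematicalPhysics.QuantumFieldTheory.U1GinibreComparison
import Literature.MathematicalPhysics.QuantumFieldTheory.LatticeGaugeProofs
import Summits.QuantumFields.YangMills.Theorems.SoloBlindSinglePlaquette
import Summits.QuantumFields.YangMills.Theorems.SoloInformedU1HelicityTorus
import Summits.QuantumFields.YangMills.Theses.U1DipoleHelicity

/-!
# `U1MeanPlaqToOneD4` — the mean plaquette of every weak-coupling limit state of Wilson U(1)₄ tends to one

Route `U1DipoleHelicity` (LINE 4 of the ideator cell ym-idea-2; an abelian COMPARISON line onto the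
node `Theorems.U1HelicityGapD4`, not a rung of `YangMills`), support item stmt-QuantumFields-25883
`Summit.QuantumFields.YangMills.Theses.U1DipoleHelicity.U1MeanPlaqToOneD4`:
for every `ε > 0` there is `β₁` such that every infinite-volume torus limit state `μ` of
Wilson-action `U(1)₄` at `β > β₁` has `⟨cos θ_p⟩_μ ≥ 1 − ε`.

Proof. Not Ginibre + Bessel asymptotics (the planner's sketch), but the tree's stronger
one-point theorem at weak coupling, `SoloBlind.weakCoupling_singlePlaquette` (Chatterjee's leading
term of the free energy + Griffiths' convexity lemma): for every unitary model,
`β ⟨N − Re tr ρ(U_p)⟩_{Λ_{L+1},β} → N²/d` for large `β` and then large tori. For `ρ = u1Rep`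
(`N = 1`, `d = 4`; `isUnitaryModel_u1Rep`) this gives `⟨1 − cos θ_p⟩_{Λ_{L+1},β} ≤ 5/(4β) ≤ ε`
uniformly in large `L`, i.e. `U1Helicity.torusMeanPlaq β M ≥ 1 − ε`
(`torusMeanPlaq_eq_one_sub`), and the torus mean plaquettes converge to `⟨cos θ_p⟩_μ` along the
defining subsequence of a limit state (`U1Helicity.tendsto_torusMeanPlaq`).

Nothing here bears on the Yang–Mills mass gap: the line is the abelian comparison statement
(Wilson U(1)₄ masslessness); this file is its elementary one-point support lemma.
-/

noncomputable section

namespace Summit.QuantumFields.YangMills.Theorems.U1DipoleHelicity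

open MeasureTheory Filter Topology
open Literature.MathematicalPhysics.QuantumLattice Literature.MathematicalPhysics.QuantumFieldTheory
open Summit.QuantumFields.YangMills.Theorems.U1Helicity

/-- **`u1Rep : U(1) → M₁(ℂ)` is a unitary model** (`G ≅ U(1)` through `ρ`): continuous, faithful,
with image exactly the unitary `1 × 1` matrices. [folklore] -/
theorem isUnitaryModel_u1Rep : IsUnitaryModel u1Rep := by
  refine ⟨continuous_u1Rep, u1Rep_injective, ?_⟩
  ext M
  constructor
  · rintro ⟨z, rfl⟩
    exact u1Rep_mem_unitaryGroup z
  · intro hM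
    have hmul : M * star M = 1 := Matrix.mem_unitaryGroup_iff.1 hM
    have h00 : M 0 0 * (starRingEnd ℂ) (M 0 0) = 1 := by
      have h := congrFun (congrFun hmul 0) 0
      simpa [Matrix.mul_apply, Matrix.star_apply] using h
    have hnorm : ‖M 0 0‖ = 1 := by
      have h1 : Complex.normSq (M 0 0) = 1 := by
        have h2 : ((Complex.normSq (M 0 0) : ℝ) : ℂ) = 1 := by rw [Complex.normSq_eq_conj_mul_self]; rw [mul_comm]; exact h00
        exact_mod_cast h2
      have h3 : ‖M 0 0‖ ^ 2 = 1 := by rw [← Complex.normSq_eq_norm_sq]; exact h1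
      have h4 : 0 ≤ ‖M 0 0‖ := norm_nonneg _
      nlinarith [h3, h4]
    refine ⟨⟨M 0 0, by simp [Submonoid.unitSphere, hnorm]⟩, ?_⟩
    ext i j
    fin_cases i; fin_cases j
    simp [u1Rep_apply, Matrix.scalar_apply]

/-- The torus mean plaquette is one minus the expected plaquette cost of `u1Rep` at the origin:
`⟨cos θ_{(0;0,1)}⟩_{Λ_{M+1},β} = 1 − ⟨1 − Re tr u1Rep(U_{0,01})⟩_{Λ_{M+1},β}`. [folklore] -/
theorem torusMeanPlaq_eq_one_sub (β : ℝ) (M : ℕ) :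
    torusMeanPlaq β M =
      1 - wilsonExpectation (L := M + 1) u1Rep β
        (SoloBlind.plaquetteCost u1Rep (0 : Site 4 (M + 1)) 0 1) := by
  haveI := isProbabilityMeasure_wilsonMeasure (d := 4) (L := M + 1) (G := Circle) u1Rep
    continuous_u1Rep β
  have hX : Integrable (fun U : GaugeConfig 4 (M + 1) Circle =>
      ((plaquetteHolonomy U (0 : Site 4 (M + 1)) 0 1 : Circle) : ℂ).re) (wilsonMeasure u1Rep β) := by
    refine Integrable.of_bound (C := 1) ?_ (ae_of_all _ fun U => ?_)
    · have hc : Continuous fun z : Circle => ((z : ℂ)).re :=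
        Complex.continuous_re.comp continuous_subtype_val
      exact (hc.measurable.comp
        (measurable_plaquetteHolonomy (0 : Site 4 (M + 1)) 0 1)).aestronglyMeasurable
    · rw [Real.norm_eq_abs]
      exact (Complex.abs_re_le_norm _).trans (le_of_eq (Circle.norm_coe _))
  have h1 : torusMeanPlaq β M = ∫ U, ((plaquetteHolonomy U (0 : Site 4 (M + 1)) 0 1 : Circle) : ℂ).re
      ∂(wilsonMeasure u1Rep β) := by
    simp only [torusMeanPlaq, wilsonExpectation, toTorusObservable_apply, plaquette_torusLift,
      Literature.MathematicalPhysics.QuantumFieldTheory.torusProj_zero]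
  have h2 : wilsonExpectation (L := M + 1) u1Rep β
      (SoloBlind.plaquetteCost u1Rep (0 : Site 4 (M + 1)) 0 1) =
      1 - ∫ U, ((plaquetteHolonomy U (0 : Site 4 (M + 1)) 0 1 : Circle) : ℂ).re
        ∂(wilsonMeasure u1Rep β) := by
    simp only [wilsonExpectation, SoloBlind.plaquetteCost, trace_u1Rep_re, Nat.cast_one]
    rw [integral_sub (integrable_const _) hX, integral_const, probReal_univ, one_smul]
  rw [h1, h2]
  ring

/-- **The torus form, uniform in the volume**: for every `ε > 0` there is `β₁` such that for every
`β > β₁` the torus mean plaquettes satisfy `⟨cos θ_p⟩_{Λ_{M+1},β} ≥ 1 − ε` for all large `M`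
(from `SoloBlind.weakCoupling_singlePlaquette`: `β⟨1 − cos θ_p⟩ ≤ 1/4 + 1` eventually, and
`5/(4β) ≤ ε`). [folklore] -/
theorem torusMeanPlaq_ge_eventually :
    ∀ ε : ℝ, 0 < ε → ∃ β₁ : ℝ, ∀ β : ℝ, β₁ < β →
      ∀ᶠ M : ℕ in atTop, 1 - ε ≤ torusMeanPlaq β M := by
  intro ε hε
  have hsp := SoloBlind.weakCoupling_singlePlaquette (d := 4) u1Rep (by norm_num) le_rfl
    isUnitaryModel_u1Rep 1 one_pos
  have hβ := hsp.and (eventually_ge_atTop (5 / (4 * ε)))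
  obtain ⟨β₁, hβ₁⟩ := Filter.eventually_atTop.1 hβ
  refine ⟨max β₁ 0, fun β hb => ?_⟩
  have hb1 : β₁ ≤ β := le_trans (le_max_left _ _) hb.le
  have hb0 : 0 < β := lt_of_le_of_lt (le_max_right _ _) hb
  obtain ⟨hL, hβε⟩ := hβ₁ β hb1
  filter_upwards [hL] with M hM
  have h := hM (0 : Site 4 (M + 1)) 0 1 (by decide)
  rw [torusMeanPlaq_eq_one_sub]
  have habs := (abs_le.1 h).2
  -- `β · cost ≤ 5/4`, `β ≥ 5/(4ε)` ⇒ `cost ≤ ε`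
  have hcost : β * wilsonExpectation (L := M + 1) u1Rep β
      (SoloBlind.plaquetteCost u1Rep (0 : Site 4 (M + 1)) 0 1) ≤ 5 / 4 := by
    norm_num at habs ⊢
    linarith
  have hβε' : 5 / 4 ≤ β * ε := by
    have := (div_le_iff₀ (by positivity : (0 : ℝ) < 4 * ε)).1 hβε
    linarith
  have : wilsonExpectation (L := M + 1) u1Rep β
      (SoloBlind.plaquetteCost u1Rep (0 : Site 4 (M + 1)) 0 1) ≤ ε := by
    by_contra hcon
    have hcon := lt_of_not_ge hcon
    have : β * ε < β * wilsonExpectation (L := M + 1) u1Rep β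
        (SoloBlind.plaquetteCost u1Rep (0 : Site 4 (M + 1)) 0 1) := mul_lt_mul_of_pos_left hcon hb0
    linarith
  linarith

/-- **Support item stmt-QuantumFields-25883 `U1MeanPlaqToOneD4`, proved**: for every `ε > 0` there
is `β₁` such that every infinite-volume torus limit state `μ` of Wilson `U(1)₄` at `β > β₁` has
mean plaquette `⟨cos θ_p⟩_μ ≥ 1 − ε` (torus bound `torusMeanPlaq_ge_eventually`, passed to the
limit along the defining subsequence by `U1Helicity.tendsto_torusMeanPlaq`). An elementary
one-point lemma of the abelian comparison line; it proves nothing about the Yang–Mills mass gap.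
[folklore] -/
theorem u1MeanPlaqToOneD4_proof :
    Summit.QuantumFields.YangMills.Theses.U1DipoleHelicity.U1MeanPlaqToOneD4 := by
  intro ε hε
  obtain ⟨β₁, hβ₁⟩ := torusMeanPlaq_ge_eventually ε hε
  refine ⟨β₁, fun β hb μ hμ => ?_⟩
  obtain ⟨φ, hφ, hlim⟩ := hμ
  have ht := tendsto_torusMeanPlaq hlim
  refine ge_of_tendsto ht ?_
  exact hφ.tendsto_atTop.eventually (hβ₁ β hb)

end Summit.QuantumFields.YangMills.Theorems.U1DipoleHelicity
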